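import Literature.Analysis.FluidPDE.AxisymmetricTypeIGauge
import Literature.Analysis.FluidPDE.NormalisedPressureL2Finite
import Literature.Analysis.FluidPDE.CKNEpsilonRegularity
import HarnessLib

/-!
# Integrability of the normalised pressure of `axisymmetric_typeI_bounded` up to the final time

Analysis/FluidPDE proofs-layer file (theorems only), sequel of `AxisymmetricTypeIData.lean` /
`AxisymmetricTypeIGauge.lean` on the decomposition path of
`Literature.Analysis.FluidPDE.knss_no_axisymmetric_typeI` through the local inputs of
`AxisymmetricTypeIBounded.lean`. The gauged pressure `q(t, ·) = p̃[u(t)]` (normalised pressure,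
a.e. in `t`) of `AxisymmetricTypeIHyp ν T u p` is controlled up to the final time `T` by the
Type I rate and the energy, through the PROVED `L²` bound
`‖p̃[w]‖_{L²} ≤ 27 M_λ ‖|w|²‖_{L²}` (`eLpNorm_normalisedPressure_le_of_integrable`):

* `AxisymmetricTypeIHyp.lintegral_enorm_pow_four_le` — `∫ |u(t)|⁴ ≤ (C²/(T−t)) ∫ |u(t)|²`;
* `AxisymmetricTypeIHyp.eLpNorm_normalisedPressure_le` —
  `‖p̃[u(t)]‖_{L²} ≤ 27 M_λ · C (T−t)^{-1/2} (2E)^{1/2}` for `0 ≤ t < T`;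
* `AxisymmetricTypeIHyp.lintegral_Ioo_eLpNorm_normalisedPressure_rpow_lt_top` —
  `∫₀ᵀ ‖p̃[u(t)]‖_{L²}^{3/2} dt < ∞` ("`p̃ ∈ L^{3/2}_t L²_x`", the rate `(T−t)^{-3/4}` being integrable);
* `setLIntegral_rpow_threeHalves_le_of_sq` — Hölder on a set of finite measure,
  `∫_B |g|^{3/2} ≤ |B|^{1/4} (∫_B |g|²)^{3/4}`;
* `AxisymmetricTypeIHyp.lintegral_cylinder_gauged_pressure_lt_top` — for a gauged pressure `q`
  (`exists_gauged_pressure`), `∫∫_{Q_r(T, x₀)} |q|^{3/2} < ∞` on every backward cylinder with top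
  time `T` (Tonelli's inequality, Hölder on the slices, and the previous bound): the hypothesis
  "`q ∈ L^{3/2}` of the cylinder" of Seregin–Šverák 2009 Thm. 3.1 and of the ε-regularity
  criteria.

## References

* G. Seregin, V. Šverák, Comm. PDE 34 (2009), Thm. 3.1 (hypothesis `q ∈ L^{3/2}(Q)`).
  [SereginSverak2009]
* T. Tao, Anal. PDE 6 (2013), Lemma 4.1 (i), (35). [Tao2011]
-/

noncomputable section

open MeasureTheory Set Function Filter Topology TopologicalSpace Metric
open scoped NNReal ENNReal

namespace Literature.Analysis.FluidPDE

/-- Local notation for physical space `ℝ³ = EuclideanSpace ℝ (Fin 3)`. -/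
local notation "ℝ³" => EuclideanSpace ℝ (Fin 3)

/-! ### Hölder on slices -/

/-- **Hölder on a set of finite measure**: `∫_B |g|^{3/2} ≤ |B|^{1/4} (∫_B |g|²)^{3/4}` for `g`
a.e. measurable on `B` (`setLIntegral_rpow_le_rpow_mul_measure` with `a = 3/2`, `b = 2`).
[folklore] -/
theorem setLIntegral_rpow_threeHalves_le_of_sq {α : Type*} [MeasurableSpace α] (μ : Measure α)
    (B : Set α) {g : α → ℝ} (hg : AEMeasurable g (μ.restrict B)) :
    ∫⁻ x in B, ‖g x‖ₑ ^ (3 / 2 : ℝ) ∂μ ≤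
      (∫⁻ x in B, ‖g x‖ₑ ^ 2 ∂μ) ^ (3 / 4 : ℝ) * μ B ^ (1 / 4 : ℝ) := by
  have h := setLIntegral_rpow_le_rpow_mul_measure μ B (F := fun x => ‖g x‖ₑ) hg.enorm
    (a := 3 / 2) (b := 2) (by norm_num) (by norm_num)
  have h1 : (3 / 2 : ℝ) / 2 = 3 / 4 := by norm_num
  rw [h1] at h
  have h2 : (1 : ℝ) - 3 / 4 = 1 / 4 := by norm_num
  rw [h2] at h
  simpa only [ENNReal.rpow_two] using h

namespace AxisymmetricTypeIHyp

variable {ν T : ℝ} {u : ℝ → ℝ³ → ℝ³} {p : ℝ → ℝ³ → ℝ}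

/-! ### The fourth power and the `L²` norm of the normalised pressure -/

/-- `∫ |u(t)|⁴ ≤ (C/√(T−t))² ∫ |u(t)|²` under the rate `√(T−t)|u(t, ·)| ≤ C`. [folklore] -/
theorem lintegral_enorm_pow_four_le_of_rate {C t : ℝ}
    (hC : ∀ x, Real.sqrt (T - t) * ‖u t x‖ ≤ C) (ht : t < T) :
    ∫⁻ x, ‖u t x‖ₑ ^ 4 ≤ ENNReal.ofReal (C / Real.sqrt (T - t)) ^ 2 * eEnergy (u t) := by
  rw [eEnergy, ← lintegral_const_mul' _ _ (ENNReal.pow_ne_top ENNReal.ofReal_ne_top)]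
  refine lintegral_mono fun x => ?_
  have h1 : ‖u t x‖ₑ ≤ ENNReal.ofReal (C / Real.sqrt (T - t)) := by
    rw [← ofReal_norm]
    exact ENNReal.ofReal_le_ofReal (norm_le_div_sqrt hC ht x)
  calc ‖u t x‖ₑ ^ 4 = ‖u t x‖ₑ ^ 2 * ‖u t x‖ₑ ^ 2 := by ring
    _ ≤ ENNReal.ofReal (C / Real.sqrt (T - t)) ^ 2 * ‖u t x‖ₑ ^ 2 := by gcongr

/-- The smooth slices have `|u(t)|² ∈ L¹` (finite energy, continuity). [folklore] -/
theorem integrable_norm_sq (H : AxisymmetricTypeIHyp ν T u p) {t : ℝ} (ht : t ∈ Ico 0 T) :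
    Integrable (fun x => ‖u t x‖ ^ 2) (volume : Measure ℝ³) := by
  have hmem : MemLp (u t) 2 volume := H.lerayHopf.memLp t ⟨ht.1, ht.2.le⟩
  simpa using hmem.integrable_norm_pow two_ne_zero

/-- **The `L²` norm of the normalised pressure under the Type I rate**:
`‖p̃[u(t)]‖_{L²} ≤ 27 M_λ · (C / √(T − t)) · (2E(u(0)))^{1/2}` for `0 ≤ t < T`
(`eLpNorm_normalisedPressure_le_of_integrable`, `lintegral_enorm_pow_four_le_of_rate`,
`eEnergy_le`). [cite: Tao2011, (35) and Lemma 4.1 (i)] -/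
theorem eLpNorm_normalisedPressure_le (H : AxisymmetricTypeIHyp ν T u p) {C : ℝ}
    (hC : ∀ t ∈ Ico 0 T, ∀ x, Real.sqrt (T - t) * ‖u t x‖ ≤ C) {t : ℝ} (ht : t ∈ Ico 0 T) :
    eLpNorm (normalisedPressure (u t)) 2 volume ≤
      ENNReal.ofReal (27 * regLaplacianMass) * (ENNReal.ofReal (C / Real.sqrt (T - t)) *
        ENNReal.ofReal (2 * VectorCalculus.kineticEnergy (u 0)) ^ (1 / 2 : ℝ)) := by
  have hu := H.classical.contDiff_velocity ht
  have hL2 := H.integrable_norm_sq ht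
  refine (eLpNorm_normalisedPressure_le_of_integrable hu hL2).trans (mul_le_mul' le_rfl ?_)
  -- `‖|u|²‖_{L²} = (∫|u|⁴)^{1/2}`
  have h4 : eLpNorm (fun y => ‖u t y‖ ^ 2) 2 volume = (∫⁻ x, ‖u t x‖ₑ ^ 4) ^ (1 / 2 : ℝ) := by
    have hsq := eLpNorm_two_sq_eq_lintegral (volume : Measure ℝ³) (fun y => ‖u t y‖ ^ 2)
    have hint : ∫⁻ x, ‖(fun y => ‖u t y‖ ^ 2) x‖ₑ ^ 2 = ∫⁻ x, ‖u t x‖ₑ ^ 4 := by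
      refine lintegral_congr fun x => ?_
      simp only
      rw [Real.enorm_eq_ofReal (sq_nonneg _), ← ENNReal.ofReal_pow (sq_nonneg _),
        ← ofReal_norm, ← ENNReal.ofReal_pow (norm_nonneg _), ← pow_mul]
    rw [← hint, ← hsq, ← ENNReal.rpow_natCast, ← ENNReal.rpow_mul]
    norm_num
  rw [h4]
  calc (∫⁻ x, ‖u t x‖ₑ ^ 4) ^ (1 / 2 : ℝ)
      ≤ (ENNReal.ofReal (C / Real.sqrt (T - t)) ^ 2 * eEnergy (u t)) ^ (1 / 2 : ℝ) :=
        ENNReal.rpow_le_rpow (lintegral_enorm_pow_four_le_of_rate (hC t ht) ht.2) (by norm_num)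
    _ ≤ (ENNReal.ofReal (C / Real.sqrt (T - t)) ^ 2 *
          ENNReal.ofReal (2 * VectorCalculus.kineticEnergy (u 0))) ^ (1 / 2 : ℝ) := by
        gcongr
        exact H.eEnergy_le ht
    _ = ENNReal.ofReal (C / Real.sqrt (T - t)) *
          ENNReal.ofReal (2 * VectorCalculus.kineticEnergy (u 0)) ^ (1 / 2 : ℝ) := by
        rw [ENNReal.mul_rpow_of_nonneg _ _ (by norm_num), ← ENNReal.rpow_natCast,
          ← ENNReal.rpow_mul]
        norm_num

/-! ### `p̃ ∈ L^{3/2}_t L²_x` of the slab -/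

/-- `∫₀ᵀ (T − t)^{-3/4} dt < ∞` as a lower Lebesgue integral (the rate `(T−t)^{-1/2}` to the power
`3/2` is integrable). [folklore] -/
theorem lintegral_Ioo_rpow_neg_three_quarters_lt_top (T : ℝ) :
    ∫⁻ t in Ioo 0 T, ENNReal.ofReal ((T - t) ^ (-(3 / 4 : ℝ))) < ∞ := by
  rcases le_or_gt T 0 with hT | hT
  · rw [Ioo_eq_empty_of_le hT]; simp
  have hr : (-1 : ℝ) < -(3 / 4 : ℝ) := by norm_num
  have h1 : IntervalIntegrable (fun s : ℝ => s ^ (-(3 / 4 : ℝ))) volume (T - T) (T - 0) :=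
    intervalIntegral.intervalIntegrable_rpow' hr
  have h2 := h1.comp_sub_left T
  simp only [sub_zero, sub_self] at h2
  have hint : IntegrableOn (fun t : ℝ => (T - t) ^ (-(3 / 4 : ℝ))) (Ioo 0 T) :=
    (h2.symm.1).mono_set Ioo_subset_Ioc_self
  have hnn : 0 ≤ᵐ[volume.restrict (Ioo 0 T)] fun t : ℝ => (T - t) ^ (-(3 / 4 : ℝ)) :=
    (ae_restrict_mem measurableSet_Ioo).mono fun t ht => Real.rpow_nonneg (sub_pos.2 ht.2).le _
  rw [← ofReal_integral_eq_lintegral_ofReal hint hnn]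
  exact ENNReal.ofReal_lt_top

/-- **`p̃[u] ∈ L^{3/2}(0, T; L²)`**: `∫₀ᵀ ‖p̃[u(t)]‖_{L²}^{3/2} dt < ∞` under the standing
hypotheses (the `L²` bound of `eLpNorm_normalisedPressure_le` is `O((T−t)^{-1/2})`).
[cite: Tao2011, (35) and Lemma 4.1 (i)] -/
theorem lintegral_Ioo_eLpNorm_normalisedPressure_rpow_lt_top (H : AxisymmetricTypeIHyp ν T u p) :
    ∫⁻ t in Ioo 0 T, eLpNorm (normalisedPressure (u t)) 2 volume ^ (3 / 2 : ℝ) < ∞ := by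
  obtain ⟨C, hC0, hC⟩ := H.exists_typeI_rate
  set K : ℝ≥0∞ := ENNReal.ofReal (27 * regLaplacianMass) *
    ENNReal.ofReal (2 * VectorCalculus.kineticEnergy (u 0)) ^ (1 / 2 : ℝ) with hK
  have hKtop : K ≠ ∞ :=
    ENNReal.mul_ne_top ENNReal.ofReal_ne_top
      (ENNReal.rpow_ne_top_of_nonneg (by norm_num) ENNReal.ofReal_ne_top)
  -- pointwise bound for `0 < t < T`
  have hpt : ∀ t ∈ Ioo 0 T, eLpNorm (normalisedPressure (u t)) 2 volume ^ (3 / 2 : ℝ) ≤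
      K ^ (3 / 2 : ℝ) * ENNReal.ofReal (C ^ (3 / 2 : ℝ) * (T - t) ^ (-(3 / 4 : ℝ))) := by
    intro t ht
    have h1 := H.eLpNorm_normalisedPressure_le hC ⟨ht.1.le, ht.2⟩
    have hTt : 0 < T - t := sub_pos.2 ht.2
    have h2 : eLpNorm (normalisedPressure (u t)) 2 volume ≤
        K * ENNReal.ofReal (C * (T - t) ^ (-(1 / 2 : ℝ))) := by
      refine h1.trans (le_of_eq ?_)
      rw [hK, Real.sqrt_eq_rpow, Real.rpow_neg hTt.le, div_eq_mul_inv]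
      ring
    calc eLpNorm (normalisedPressure (u t)) 2 volume ^ (3 / 2 : ℝ)
        ≤ (K * ENNReal.ofReal (C * (T - t) ^ (-(1 / 2 : ℝ)))) ^ (3 / 2 : ℝ) :=
          ENNReal.rpow_le_rpow h2 (by norm_num)
      _ = K ^ (3 / 2 : ℝ) * ENNReal.ofReal (C ^ (3 / 2 : ℝ) * (T - t) ^ (-(3 / 4 : ℝ))) := by
          rw [ENNReal.mul_rpow_of_nonneg _ _ (by norm_num),
            ENNReal.ofReal_rpow_of_nonneg (mul_nonneg hC0 (Real.rpow_nonneg hTt.le _)) (by norm_num),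
            Real.mul_rpow hC0 (Real.rpow_nonneg hTt.le _), ← Real.rpow_mul hTt.le]
          norm_num
  calc ∫⁻ t in Ioo 0 T, eLpNorm (normalisedPressure (u t)) 2 volume ^ (3 / 2 : ℝ)
      ≤ ∫⁻ t in Ioo 0 T, K ^ (3 / 2 : ℝ) * ENNReal.ofReal (C ^ (3 / 2 : ℝ) * (T - t) ^ (-(3 / 4 : ℝ))) :=
        setLIntegral_mono' measurableSet_Ioo fun t ht => hpt t ht
    _ = K ^ (3 / 2 : ℝ) * (ENNReal.ofReal (C ^ (3 / 2 : ℝ)) *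
          ∫⁻ t in Ioo 0 T, ENNReal.ofReal ((T - t) ^ (-(3 / 4 : ℝ)))) := by
        rw [← lintegral_const_mul' _ _ ENNReal.ofReal_ne_top,
          ← lintegral_const_mul' _ _ (ENNReal.rpow_ne_top_of_nonneg (by norm_num) hKtop)]
        refine lintegral_congr fun t => ?_
        rw [ENNReal.ofReal_mul (Real.rpow_nonneg hC0 _)]
    _ < ∞ := by
        refine ENNReal.mul_lt_top (ENNReal.rpow_lt_top_of_nonneg (by norm_num) hKtop)
          (ENNReal.mul_lt_top ENNReal.ofReal_lt_top (lintegral_Ioo_rpow_neg_three_quarters_lt_top T))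

/-! ### Bounds on backward cylinders with top time `T` -/

/-- **`u ∈ L³` of every backward cylinder with top time `T`** (and radius `r` with `r² ≤ T`):
`∫∫_{Q_r(T, x₀)} |u|³ ≤ ∫₀ᵀ ∫ |u|³ < ∞` (Tonelli's inequality `lintegral_prod_le`).
[cite: SereginSverak2009, Thm 3.1 (hypothesis v ∈ L³(Q))] -/
theorem lintegral_cylinder_enorm_pow_three_lt_top (H : AxisymmetricTypeIHyp ν T u p) {r : ℝ}
    (hr : r ^ 2 ≤ T) (x₀ : ℝ³) :
    ∫⁻ z in parabolicCylinder r ((T : ℝ), x₀), ‖u z.1 z.2‖ₑ ^ (3 : ℕ) < ∞ := by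
  have hI : Ioo (T - r ^ 2) T ⊆ Ioo 0 T := Ioo_subset_Ioo_left (by linarith)
  calc ∫⁻ z in parabolicCylinder r ((T : ℝ), x₀), ‖u z.1 z.2‖ₑ ^ (3 : ℕ)
      = ∫⁻ z, ‖u z.1 z.2‖ₑ ^ (3 : ℕ)
          ∂((volume.restrict (Ioo (T - r ^ 2) T)).prod (volume.restrict (ball x₀ r))) := by
        rw [Measure.prod_restrict, ← Measure.volume_eq_prod]; rfl
    _ ≤ ∫⁻ t in Ioo (T - r ^ 2) T, ∫⁻ x in ball x₀ r, ‖u t x‖ₑ ^ (3 : ℕ) := lintegral_prod_le _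
    _ ≤ ∫⁻ t in Ioo 0 T, ∫⁻ x, ‖u t x‖ₑ ^ (3 : ℕ) :=
        (lintegral_mono_set hI).trans (lintegral_mono fun t => setLIntegral_le_lintegral _ _)
    _ < ∞ := H.lintegral_Ioo_lintegral_enorm_pow_three_lt_top

/-- **Slice Hölder for the gauged pressure**: for a.e. `t ∈ (0, T)`, on a ball `B`,
`∫_B |q(t)|^{3/2} ≤ |B|^{1/4} ‖p̃[u(t)]‖_{L²}^{3/2}`. [folklore] -/
theorem ae_setLIntegral_gauged_pressure_le (H : AxisymmetricTypeIHyp ν T u p) {q : ℝ → ℝ³ → ℝ}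
    (hq : ∀ᵐ t ∂(volume.restrict (Ioo 0 T)), q t = normalisedPressure (u t)) (B : Set ℝ³) :
    ∀ᵐ t ∂(volume.restrict (Ioo 0 T)), ∫⁻ x in B, ‖q t x‖ₑ ^ (3 / 2 : ℝ) ≤
      eLpNorm (normalisedPressure (u t)) 2 volume ^ (3 / 2 : ℝ) * volume B ^ (1 / 4 : ℝ) := by
  filter_upwards [hq, ae_restrict_mem measurableSet_Ioo] with t ht htI
  rw [ht]
  have hm : AEStronglyMeasurable (normalisedPressure (u t)) volume :=
    aestronglyMeasurable_normalisedPressure_of_integrable (H.classical.contDiff_velocity ⟨htI.1.le, htI.2⟩)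
      (H.integrable_norm_sq ⟨htI.1.le, htI.2⟩)
  refine (setLIntegral_rpow_threeHalves_le_of_sq volume B hm.aemeasurable.restrict).trans ?_
  gcongr
  -- `(∫_B |g|²)^{3/4} ≤ (‖g‖²_{L²})^{3/4} = ‖g‖_{L²}^{3/2}`
  calc (∫⁻ x in B, ‖normalisedPressure (u t) x‖ₑ ^ 2) ^ (3 / 4 : ℝ)
      ≤ (∫⁻ x, ‖normalisedPressure (u t) x‖ₑ ^ 2) ^ (3 / 4 : ℝ) :=
        ENNReal.rpow_le_rpow (setLIntegral_le_lintegral _ _) (by norm_num)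
    _ = eLpNorm (normalisedPressure (u t)) 2 volume ^ (3 / 2 : ℝ) := by
        rw [← eLpNorm_two_sq_eq_lintegral, ← ENNReal.rpow_natCast, ← ENNReal.rpow_mul]
        norm_num

/-- **`q ∈ L^{3/2}` of every backward cylinder with top time `T`** for a gauged pressure `q`
(`q(t) = p̃[u(t)]` a.e. in `t`; radius `r` with `r² ≤ T`): Tonelli's inequality, Hölder on the
slices (`ae_setLIntegral_gauged_pressure_le`) and `p̃ ∈ L^{3/2}_t L²_x`. This is the hypothesis
"`q ∈ L^{3/2}(Q)`" of Seregin–Šverák 2009, Thm. 3.1 and of the ε-regularity criteria.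
[cite: SereginSverak2009, Thm 3.1 (hypothesis q ∈ L^{3/2}(Q))] -/
theorem lintegral_cylinder_gauged_pressure_lt_top (H : AxisymmetricTypeIHyp ν T u p)
    {q : ℝ → ℝ³ → ℝ} (hq : ∀ᵐ t ∂(volume.restrict (Ioo 0 T)), q t = normalisedPressure (u t))
    {r : ℝ} (hr : r ^ 2 ≤ T) (x₀ : ℝ³) :
    ∫⁻ z in parabolicCylinder r ((T : ℝ), x₀), ‖q z.1 z.2‖ₑ ^ (3 / 2 : ℝ) < ∞ := by
  have hI : Ioo (T - r ^ 2) T ⊆ Ioo 0 T := Ioo_subset_Ioo_left (by linarith)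
  have hB : volume (ball x₀ r) ^ (1 / 4 : ℝ) ≠ ∞ :=
    ENNReal.rpow_ne_top_of_nonneg (by norm_num) measure_ball_lt_top.ne
  calc ∫⁻ z in parabolicCylinder r ((T : ℝ), x₀), ‖q z.1 z.2‖ₑ ^ (3 / 2 : ℝ)
      = ∫⁻ z, ‖q z.1 z.2‖ₑ ^ (3 / 2 : ℝ)
          ∂((volume.restrict (Ioo (T - r ^ 2) T)).prod (volume.restrict (ball x₀ r))) := by
        rw [Measure.prod_restrict, ← Measure.volume_eq_prod]; rfl
    _ ≤ ∫⁻ t in Ioo (T - r ^ 2) T, ∫⁻ x in ball x₀ r, ‖q t x‖ₑ ^ (3 / 2 : ℝ) := lintegral_prod_le _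
    _ ≤ ∫⁻ t in Ioo (T - r ^ 2) T,
          eLpNorm (normalisedPressure (u t)) 2 volume ^ (3 / 2 : ℝ) * volume (ball x₀ r) ^ (1 / 4 : ℝ) :=
        lintegral_mono_ae (ae_restrict_of_ae_restrict_of_subset hI
          (H.ae_setLIntegral_gauged_pressure_le hq (ball x₀ r)))
    _ ≤ ∫⁻ t in Ioo 0 T,
          eLpNorm (normalisedPressure (u t)) 2 volume ^ (3 / 2 : ℝ) * volume (ball x₀ r) ^ (1 / 4 : ℝ) :=
        lintegral_mono_set hI
    _ = (∫⁻ t in Ioo 0 T, eLpNorm (normalisedPressure (u t)) 2 volume ^ (3 / 2 : ℝ)) *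
          volume (ball x₀ r) ^ (1 / 4 : ℝ) := by rw [lintegral_mul_const' _ _ hB]
    _ < ∞ := ENNReal.mul_lt_top H.lintegral_Ioo_eLpNorm_normalisedPressure_rpow_lt_top
        hB.lt_top

end AxisymmetricTypeIHyp

end Literature.Analysis.FluidPDE

end
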